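import Literature.NumberTheory.Sieve.PairShiuCounting
import Literature.NumberTheory.Sieve.PairShiuLocal
import HarnessLib

/-!
# The bivariate Shiu bound: class I

Topic `Literature/NumberTheory/Sieve`. Everything here is PROVED; no definition is introduced.
Class I of Shiu's method (J. reine angew. Math. 313 (1980), §5, `∑_I`) for the pair of linear
forms `(n, mn + h)`: the `1 ≤ n ≤ N` whose cut prime `P_n` (of `Q(n) = n(mn+h)`, level `z = w²`)
exceeds `w`, and whose `h`-parts are at most `Y`. Writing `n = c₁d₁`, `mn + h = c₂d₂` with
`cᵢ` composed of the primes `< P_n` and `dᵢ` of those `≥ P_n > w`, one has `f(d₁)g(d₂) ≤ B^{2M}`;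
the fibre over `(c₁, c₂)` is counted by the two-dimensional sieve (`PairShiuCount.card_le`); the
`h`-parts of `(c₁, c₂)` are summed with `PairShiuLocal.sum_pairs_le` and the parts coprime to `h`
with Shiu's Euler majorant (`Shiu.rankin_tail`, `η = 0`).

## References

* P. Shiu, J. reine angew. Math. 313 (1980), 161–170, §5. [cite: Shiu1980, §5]
* K. Matomäki, J. Merikoski, IMRN 2023 (arXiv:2112.11412), Lemma 3.1. [cite: MatomakiMerikoski2023, Lemma 3.1]
-/

noncomputable section

open Finset Real

namespace Literature.NumberTheory.Sieve

namespace PairShiu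

/-! ### The odd sifting range -/

/-- The product `P° = ∏_{2 < p < w} p` of the odd primes below `w`: it divides `P(w)`, is odd,
and its prime factors are exactly the odd primes `< w`. [folklore] -/
theorem oddProd_facts (w : ℝ) :
    (∏ p ∈ (Nat.primesBelow ⌈w⌉₊).erase 2, p) ∣ primesProdBelow w ∧
    Odd (∏ p ∈ (Nat.primesBelow ⌈w⌉₊).erase 2, p) ∧
    (∏ p ∈ (Nat.primesBelow ⌈w⌉₊).erase 2, p).primeFactors = (Nat.primesBelow ⌈w⌉₊).erase 2 ∧
    (∀ p ∈ (∏ p ∈ (Nat.primesBelow ⌈w⌉₊).erase 2, p).primeFactors, p.Prime ∧ p ≠ 2 ∧ (p : ℝ) < w) := by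
  set s := (Nat.primesBelow ⌈w⌉₊).erase 2 with hs
  have hsprime : ∀ p ∈ s, p.Prime := fun p hp => (Nat.mem_primesBelow.mp (Finset.mem_erase.mp hp).2).2
  have hdvd : (∏ p ∈ s, p) ∣ primesProdBelow w := by
    rw [primesProdBelow]
    exact Finset.prod_dvd_prod_of_subset _ _ _ (Finset.erase_subset _ _)
  have hpf : (∏ p ∈ s, p).primeFactors = s := by
    rw [Nat.primeFactors_prod hsprime]
  have hodd : Odd (∏ p ∈ s, p) := by
    rw [Nat.odd_iff]
    by_contra h2
    have : 2 ∣ ∏ p ∈ s, p := Nat.dvd_of_mod_eq_zero (by omega)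
    obtain ⟨p, hp, h2p⟩ := (Prime.dvd_finsetProd_iff Nat.prime_two.prime _).mp this
    have hp2 : p = 2 := ((Nat.prime_dvd_prime_iff_eq Nat.prime_two (hsprime p hp)).mp h2p).symm
    exact (Finset.mem_erase.mp hp).1 hp2
  refine ⟨hdvd, hodd, hpf, fun p hp => ?_⟩
  rw [hpf] at hp
  obtain ⟨hp2, hpb⟩ := Finset.mem_erase.mp hp
  obtain ⟨hpw, hpp⟩ := Nat.mem_primesBelow.mp hpb
  exact ⟨hpp, hp2, Nat.lt_ceil.mp hpw⟩

/-- A number all of whose prime factors are `≥ w` is coprime to the odd sifting range below `w`.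
[folklore] -/
theorem coprime_oddProd_of_le {d : ℕ} (hd0 : d ≠ 0) {w : ℝ} (hd : ∀ p ∈ d.primeFactors, w ≤ (p : ℝ)) :
    d.Coprime (∏ p ∈ (Nat.primesBelow ⌈w⌉₊).erase 2, p) := by
  obtain ⟨-, hodd, -, hfacts⟩ := oddProd_facts w
  refine Nat.coprime_of_dvd fun p hp hpd hpP => ?_
  have hmem : p ∈ (∏ p ∈ (Nat.primesBelow ⌈w⌉₊).erase 2, p).primeFactors :=
    Nat.mem_primeFactors.mpr ⟨hp, hpP, hodd.pos.ne'⟩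
  have h1 := (hfacts p hmem).2.2
  have h2 := hd p (Nat.mem_primeFactors.mpr ⟨hp, hpd, hd0⟩)
  linarith


/-! ### A triple-product majorant -/

/-- If `c ↦ (E(c), u₁(c), u₂(c))` is injective on `T` with values in `E × U × U`, then for
non-negative weights `∑_{c ∈ T} A(E(c)) B₁(u₁(c)) B₂(u₂(c)) ≤ (∑_E A)(∑_U B₁)(∑_U B₂)`. [folklore] -/
theorem sum_le_prod_three {T E : Finset (ℕ × ℕ)} {U : Finset ℕ} (eM : ℕ × ℕ → ℕ × ℕ)
    (u₁ u₂ : ℕ × ℕ → ℕ) (A : ℕ × ℕ → ℝ) (B₁ B₂ : ℕ → ℝ)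
    (hA : ∀ e ∈ E, 0 ≤ A e) (hB₁ : ∀ u ∈ U, 0 ≤ B₁ u) (hB₂ : ∀ u ∈ U, 0 ≤ B₂ u)
    (hmaps : ∀ c ∈ T, eM c ∈ E ∧ u₁ c ∈ U ∧ u₂ c ∈ U)
    (hinj : Set.InjOn (fun c => (eM c, u₁ c, u₂ c)) T) :
    ∑ c ∈ T, A (eM c) * B₁ (u₁ c) * B₂ (u₂ c) ≤
      (∑ e ∈ E, A e) * (∑ u ∈ U, B₁ u) * ∑ u ∈ U, B₂ u := by
  classical
  set Φ : ℕ × ℕ → (ℕ × ℕ) × ℕ × ℕ := fun c => (eM c, u₁ c, u₂ c) with hΦ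
  set G : (ℕ × ℕ) × ℕ × ℕ → ℝ := fun x => A x.1 * B₁ x.2.1 * B₂ x.2.2 with hG
  have h1 : ∑ c ∈ T, A (eM c) * B₁ (u₁ c) * B₂ (u₂ c) = ∑ x ∈ T.image Φ, G x := by
    rw [Finset.sum_image (fun c₁ h₁ c₂ h₂ h => hinj h₁ h₂ h)]
  rw [h1]
  have hsub : T.image Φ ⊆ E ×ˢ (U ×ˢ U) := by
    intro x hx
    rw [Finset.mem_image] at hx
    obtain ⟨c, hc, rfl⟩ := hx
    obtain ⟨he, hu1, hu2⟩ := hmaps c hc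
    simp only [hΦ, Finset.mem_product]
    exact ⟨he, hu1, hu2⟩
  calc ∑ x ∈ T.image Φ, G x ≤ ∑ x ∈ E ×ˢ (U ×ˢ U), G x := by
        refine Finset.sum_le_sum_of_subset_of_nonneg hsub fun x hx _ => ?_
        simp only [Finset.mem_product] at hx
        simp only [hG]
        exact mul_nonneg (mul_nonneg (hA _ hx.1) (hB₁ _ hx.2.1)) (hB₂ _ hx.2.2)
    _ = (∑ e ∈ E, A e) * (∑ u ∈ U, B₁ u) * ∑ u ∈ U, B₂ u := by
        rw [Finset.sum_product]
        simp only [hG]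
        rw [Finset.sum_mul, Finset.sum_mul]
        refine Finset.sum_congr rfl fun e _ => ?_
        rw [Finset.sum_product, mul_assoc, Finset.sum_mul_sum, Finset.mul_sum]
        refine Finset.sum_congr rfl fun a _ => ?_
        rw [Finset.mul_sum]
        refine Finset.sum_congr rfl fun b _ => ?_
        ring


/-! ### Two auxiliary estimates for class I -/

/-- The real-variable bookkeeping of one class-I fibre. [folklore] -/
theorem fibre_algebra {fc gc ψ1 ψ2 ψh ψm V N G Ge c1 c2 corr cnt C₀ W19 A z6 BM : ℝ}
    (hfc : 0 ≤ fc) (hgc : 0 ≤ gc) (hψ1 : 1 ≤ ψ1) (hψ2 : 1 ≤ ψ2) (hψh : 0 ≤ ψh) (hψm : 0 ≤ ψm)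
    (hV0 : 0 ≤ V) (hV1 : V ≤ 1) (hN : 0 ≤ N) (hG0 : 0 ≤ G) (hGe : G ≤ Ge) (hc1 : 0 < c1) (hc2 : 0 < c2)
    (hcorr0 : 0 ≤ corr) (hcorr : corr ≤ ψh * ψm * ψ1 * ψ2) (hC₀ : 0 ≤ C₀) (hW : 0 ≤ W19)
    (hcnt : cnt ≤ C₀ * (N * G / (c1 * c2) + 1) * (V * corr) + C₀ * W19)
    (hA : 0 ≤ A) (hfh : fc * ψ1 ≤ A * z6) (hgh : gc * ψ2 ≤ A * z6) (hz6 : 0 ≤ z6) (hBM : 0 ≤ BM) :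
    fc * gc * BM * cnt ≤
      C₀ * BM * (N * V * ψh * ψm * (fc * ψ1 * (gc * ψ2) * Ge / (c1 * c2)) +
        A ^ 2 * z6 ^ 2 * (ψh * ψm + W19)) := by
  have hfg : 0 ≤ fc * gc := mul_nonneg hfc hgc
  have hfhgh : fc * ψ1 * (gc * ψ2) ≤ A * z6 * (A * z6) :=
    mul_le_mul hfh hgh (by positivity) (by positivity)
  have hfg_le : fc * gc ≤ fc * ψ1 * (gc * ψ2) := by
    have h1 : fc ≤ fc * ψ1 := le_mul_of_one_le_right hfc hψ1
    have h2 : gc ≤ gc * ψ2 := le_mul_of_one_le_right hgc hψ2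
    exact mul_le_mul h1 h2 hgc (by positivity)
  have hGe0 : 0 ≤ Ge := hG0.trans hGe
  -- Step 1: replace `cnt`
  have hcnt' : cnt ≤ C₀ * (N * Ge / (c1 * c2) + 1) * (V * (ψh * ψm * ψ1 * ψ2)) + C₀ * W19 := by
    refine hcnt.trans (add_le_add ?_ le_rfl)
    have h1 : N * G / (c1 * c2) + 1 ≤ N * Ge / (c1 * c2) + 1 := by
      gcongr
    exact mul_le_mul (mul_le_mul_of_nonneg_left h1 hC₀) (mul_le_mul_of_nonneg_left hcorr hV0)
      (mul_nonneg hV0 hcorr0) (by positivity)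
  have hstep : fc * gc * BM * cnt ≤
      fc * gc * BM * (C₀ * (N * Ge / (c1 * c2) + 1) * (V * (ψh * ψm * ψ1 * ψ2)) + C₀ * W19) :=
    mul_le_mul_of_nonneg_left hcnt' (by positivity)
  refine hstep.trans ?_
  -- Step 2: expand and bound the three pieces
  have hpiece1 : fc * gc * (N * Ge / (c1 * c2)) * (V * (ψh * ψm * ψ1 * ψ2)) =
      N * V * ψh * ψm * (fc * ψ1 * (gc * ψ2) * Ge / (c1 * c2)) := by
    field_simp
  have hpiece2 : fc * gc * (V * (ψh * ψm * ψ1 * ψ2)) ≤ A ^ 2 * z6 ^ 2 * (ψh * ψm) := by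
    calc fc * gc * (V * (ψh * ψm * ψ1 * ψ2)) = V * (ψh * ψm) * (fc * ψ1 * (gc * ψ2)) := by ring
      _ ≤ 1 * (ψh * ψm) * (A * z6 * (A * z6)) :=
          mul_le_mul (mul_le_mul_of_nonneg_right hV1 (by positivity)) hfhgh (by positivity) (by positivity)
      _ = A ^ 2 * z6 ^ 2 * (ψh * ψm) := by ring
  have hpiece3 : fc * gc * W19 ≤ A ^ 2 * z6 ^ 2 * W19 := by
    refine mul_le_mul_of_nonneg_right (hfg_le.trans (hfhgh.trans (le_of_eq (by ring)))) hW
  have hBC : 0 ≤ C₀ * BM := mul_nonneg hC₀ hBM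
  calc fc * gc * BM * (C₀ * (N * Ge / (c1 * c2) + 1) * (V * (ψh * ψm * ψ1 * ψ2)) + C₀ * W19)
      = C₀ * BM * (fc * gc * (N * Ge / (c1 * c2)) * (V * (ψh * ψm * ψ1 * ψ2)) +
          fc * gc * (V * (ψh * ψm * ψ1 * ψ2)) + fc * gc * W19) := by ring
    _ ≤ C₀ * BM * (N * V * ψh * ψm * (fc * ψ1 * (gc * ψ2) * Ge / (c1 * c2)) +
          A ^ 2 * z6 ^ 2 * (ψh * ψm) + A ^ 2 * z6 ^ 2 * W19) := by
        rw [hpiece1]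
        exact mul_le_mul_of_nonneg_left (add_le_add (add_le_add le_rfl hpiece2) hpiece3) hBC
    _ = _ := by ring

/-- **The main sum of class I.** For `f̂, ĝ ≥ 0` multiplicative on coprime arguments with
`f̂(1) = ĝ(1) = 1`, `f̂(p^l), ĝ(p^l) ≤ B'^l`, `f̂(n), ĝ(n) ≤ A n^{1/6}`, `f̂(p^a), ĝ(p^a) ≤ Â'(p^a)^{1/8}`,
and a finite set `T` of pairs `1 ≤ c₁, c₂ ≤ z` coupled at the primes of `h` by
`v_p(c₁) = 0 ↔ v_p(c₂) = 0`:
`∑_{T} f̂(c₁)ĝ(c₂)(h(c₁), h(c₂))/(c₁c₂) ≤ e^{160Â'²} ∏_{p ∣ h}(1 + f̂(p)ĝ(p)/p) e^{E_f̂ + K₅} e^{E_ĝ + K₅}`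
(`h(c)` the `h`-part of `c`). [cite: MatomakiMerikoski2023, Lemma 3.1] -/
theorem mainSum_le {fh gh : ℕ → ℝ} (hfh0 : ∀ n, 0 ≤ fh n) (hgh0 : ∀ n, 0 ≤ gh n)
    (hfh1 : fh 1 = 1) (hgh1 : gh 1 = 1)
    (hfhmul : ∀ a b : ℕ, a.Coprime b → fh (a * b) = fh a * fh b)
    (hghmul : ∀ a b : ℕ, a.Coprime b → gh (a * b) = gh a * gh b)
    {B' : ℝ} (hB'1 : 1 ≤ B') (hfhB : ∀ p l : ℕ, p.Prime → 1 ≤ l → fh (p ^ l) ≤ B' ^ l)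
    (hghB : ∀ p l : ℕ, p.Prime → 1 ≤ l → gh (p ^ l) ≤ B' ^ l)
    {A : ℝ} (hfhA : ∀ n : ℕ, 1 ≤ n → fh n ≤ A * (n : ℝ) ^ (1 / 6 : ℝ))
    (hghA : ∀ n : ℕ, 1 ≤ n → gh n ≤ A * (n : ℝ) ^ (1 / 6 : ℝ))
    {Â' : ℝ} (hÂ' : 0 ≤ Â') (hfhÂ : ∀ p a : ℕ, p.Prime → 1 ≤ a → fh (p ^ a) ≤ Â' * ((p : ℝ) ^ a) ^ (1 / 8 : ℝ))
    (hghÂ : ∀ p a : ℕ, p.Prime → 1 ≤ a → gh (p ^ a) ≤ Â' * ((p : ℝ) ^ a) ^ (1 / 8 : ℝ))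
    {h : ℕ} (hh : h ≠ 0) {z : ℝ} (hz : 1 ≤ z) (T : Finset (ℕ × ℕ))
    (hT : ∀ c ∈ T, 1 ≤ c.1 ∧ 1 ≤ c.2 ∧ (c.1 : ℝ) ≤ z ∧ (c.2 : ℝ) ≤ z ∧
      ∀ p ∈ h.primeFactors, c.1.factorization p = 0 ↔ c.2.factorization p = 0) :
    ∑ c ∈ T, fh c.1 * gh c.2 *
        (Nat.gcd (∏ q ∈ h.primeFactors, q ^ c.1.factorization q)
          (∏ q ∈ h.primeFactors, q ^ c.2.factorization q) : ℝ) / ((c.1 : ℝ) * c.2) ≤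
      (Real.exp (160 * Â' ^ 2) * ∏ p ∈ h.primeFactors, (1 + fh p * gh p / p)) *
        (Real.exp (∑ p ∈ Shiu.primesBelowNotDvd ((⌊z⌋₊ : ℝ) + 1) 1, fh p / p + Shiu.K₅ A B') *
          Real.exp (∑ p ∈ Shiu.primesBelowNotDvd ((⌊z⌋₊ : ℝ) + 1) 1, gh p / p + Shiu.K₅ A B')) := by
  classical
  set hP : ℕ → ℕ := fun k => ∏ q ∈ h.primeFactors, q ^ k.factorization q with hhP
  set eM : ℕ × ℕ → ℕ × ℕ := fun c => (hP c.1, hP c.2) with heM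
  set u₁ : ℕ × ℕ → ℕ := fun c => c.1 / hP c.1 with hu₁
  set u₂ : ℕ × ℕ → ℕ := fun c => c.2 / hP c.2 with hu₂
  set Aw : ℕ × ℕ → ℝ := fun e => fh e.1 * gh e.2 * (Nat.gcd e.1 e.2 : ℝ) / ((e.1 : ℝ) * e.2) with hAw
  set E := T.image eM with hE
  set U := Icc 1 ⌊z⌋₊ with hU
  -- termwise factorisation
  have hterm : ∀ c ∈ T, fh c.1 * gh c.2 * (Nat.gcd (hP c.1) (hP c.2) : ℝ) / ((c.1 : ℝ) * c.2) =
      Aw (eM c) * (fh (u₁ c) / (u₁ c)) * (gh (u₂ c) / (u₂ c)) := by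
    intro c hc
    obtain ⟨hc1, hc2, -, -, -⟩ := hT c hc
    have hc10 : c.1 ≠ 0 := by omega
    have hc20 : c.2 ≠ 0 := by omega
    have hd1 : hP c.1 * u₁ c = c.1 := hPart_mul_div hc10 h
    have hd2 : hP c.2 * u₂ c = c.2 := hPart_mul_div hc20 h
    have hcop1 : (hP c.1).Coprime (u₁ c) := coprime_hPart_div hc10 hh
    have hcop2 : (hP c.2).Coprime (u₂ c) := coprime_hPart_div hc20 hh
    have hf : fh c.1 = fh (hP c.1) * fh (u₁ c) := by
      conv_lhs => rw [← hd1]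
      exact hfhmul _ _ hcop1
    have hg : gh c.2 = gh (hP c.2) * gh (u₂ c) := by
      conv_lhs => rw [← hd2]
      exact hghmul _ _ hcop2
    have hc1r : (c.1 : ℝ) = (hP c.1 : ℝ) * (u₁ c : ℝ) := by
      rw [← Nat.cast_mul]; exact_mod_cast hd1.symm
    have hc2r : (c.2 : ℝ) = (hP c.2 : ℝ) * (u₂ c : ℝ) := by
      rw [← Nat.cast_mul]; exact_mod_cast hd2.symm
    have he1 : (0 : ℝ) < hP c.1 := by exact_mod_cast Nat.pos_of_ne_zero (hPart_ne_zero h _)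
    have he2 : (0 : ℝ) < hP c.2 := by exact_mod_cast Nat.pos_of_ne_zero (hPart_ne_zero h _)
    have hu1 : (0 : ℝ) < u₁ c := by
      have : u₁ c ≠ 0 := fun h0 => hc10 (by rw [← hd1, h0, mul_zero])
      exact_mod_cast Nat.pos_of_ne_zero this
    have hu2 : (0 : ℝ) < u₂ c := by
      have : u₂ c ≠ 0 := fun h0 => hc20 (by rw [← hd2, h0, mul_zero])
      exact_mod_cast Nat.pos_of_ne_zero this
    simp only [hAw, heM]
    rw [hf, hg, hc1r, hc2r]
    field_simp
  rw [Finset.sum_congr rfl hterm]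
  -- the triple product
  have h3 := sum_le_prod_three (T := T) (E := E) (U := U) eM u₁ u₂ Aw (fun u => fh u / u) (fun u => gh u / u)
    (fun e _ => by simp only [hAw]; have := hfh0 e.1; have := hgh0 e.2; positivity)
    (fun u _ => div_nonneg (hfh0 u) (Nat.cast_nonneg u))
    (fun u _ => div_nonneg (hgh0 u) (Nat.cast_nonneg u)) ?_ ?_
  rotate_left
  · intro c hc
    obtain ⟨hc1, hc2, hc1z, hc2z, -⟩ := hT c hc
    have hc10 : c.1 ≠ 0 := by omega
    have hc20 : c.2 ≠ 0 := by omega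
    have hd1 : hP c.1 * u₁ c = c.1 := hPart_mul_div hc10 h
    have hd2 : hP c.2 * u₂ c = c.2 := hPart_mul_div hc20 h
    refine ⟨Finset.mem_image_of_mem eM hc, ?_, ?_⟩
    · rw [hU, Finset.mem_Icc]
      have hle : u₁ c ≤ c.1 := Nat.div_le_self _ _
      exact ⟨Nat.one_le_iff_ne_zero.mpr fun h0 => hc10 (by rw [← hd1, h0, mul_zero]),
        Nat.le_floor (le_trans (by exact_mod_cast hle) hc1z)⟩
    · rw [hU, Finset.mem_Icc]
      have hle : u₂ c ≤ c.2 := Nat.div_le_self _ _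
      exact ⟨Nat.one_le_iff_ne_zero.mpr fun h0 => hc20 (by rw [← hd2, h0, mul_zero]),
        Nat.le_floor (le_trans (by exact_mod_cast hle) hc2z)⟩
  · intro c hc c' hc' heq
    simp only [Prod.mk.injEq, heM] at heq
    obtain ⟨⟨h11, h12⟩, h21, h22⟩ := heq
    obtain ⟨hc1, hc2, -⟩ := hT c hc
    obtain ⟨hc1', hc2', -⟩ := hT c' hc'
    have hd1 : hP c.1 * u₁ c = c.1 := hPart_mul_div (show c.1 ≠ 0 by omega) h
    have hd1' : hP c'.1 * u₁ c' = c'.1 := hPart_mul_div (show c'.1 ≠ 0 by omega) h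
    have hd2 : hP c.2 * u₂ c = c.2 := hPart_mul_div (show c.2 ≠ 0 by omega) h
    have hd2' : hP c'.2 * u₂ c' = c'.2 := hPart_mul_div (show c'.2 ≠ 0 by omega) h
    have e1 : c.1 = c'.1 := by rw [← hd1, ← hd1', h11, h21]
    have e2 : c.2 = c'.2 := by rw [← hd2, ← hd2', h12, h22]
    exact Prod.ext e1 e2
  refine h3.trans ?_
  -- the three factors
  have hE : ∑ e ∈ E, Aw e ≤ Real.exp (160 * Â' ^ 2) * ∏ p ∈ h.primeFactors, (1 + fh p * gh p / p) := by
    have := PairShiuLocal.sum_pairs_le hfh0 hgh0 hfh1 hgh1 hfhmul hghmul hÂ' hfhÂ hghÂ h E ?_ ?_ ?_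
    · simpa only [hAw] using this
    · intro e he
      rw [hE, Finset.mem_image] at he
      obtain ⟨c, -, rfl⟩ := he
      exact ⟨hPart_ne_zero h _, hPart_ne_zero h _⟩
    · intro e he
      rw [hE, Finset.mem_image] at he
      obtain ⟨c, -, rfl⟩ := he
      exact ⟨primeFactors_hPart_subset h _, primeFactors_hPart_subset h _⟩
    · intro e he p
      rw [hE, Finset.mem_image] at he
      obtain ⟨c, hc, rfl⟩ := he
      obtain ⟨-, -, -, -, hcouple⟩ := hT c hc
      simp only [heM, hhP]
      rw [factorization_hPart, factorization_hPart]
      by_cases hp : p ∈ h.primeFactors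
      · rw [if_pos hp, if_pos hp]; exact hcouple p hp
      · rw [if_neg hp, if_neg hp]
  have hUsum : ∀ {F : ℕ → ℝ}, (∀ n, 0 ≤ F n) → F 1 = 1 → (∀ a b : ℕ, a.Coprime b → F (a * b) = F a * F b) →
      (∀ p l : ℕ, p.Prime → 1 ≤ l → F (p ^ l) ≤ B' ^ l) → (∀ n : ℕ, 1 ≤ n → F n ≤ A * (n : ℝ) ^ (1 / 6 : ℝ)) →
      ∑ u ∈ U, F u / u ≤ Real.exp (∑ p ∈ Shiu.primesBelowNotDvd ((⌊z⌋₊ : ℝ) + 1) 1, F p / p + Shiu.K₅ A B') := by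
    intro F hF0 hF1 hFmul hFB hFA
    have hfl1 : (1 : ℝ) ≤ (⌊z⌋₊ : ℝ) := by exact_mod_cast Nat.le_floor (by simpa using hz)
    have hr := Shiu.rankin_tail hF0 hF1 hFmul hB'1 hFB hFA (η := 0) le_rfl (by norm_num)
      (v := (⌊z⌋₊ : ℝ) + 1) (w := 1) (by linarith) one_pos 1 (S := U)
      (fun c hc => by have := (Finset.mem_Icc.1 hc).1; omega)
      (fun c hc => by exact_mod_cast (Finset.mem_Icc.1 hc).1)
      (fun c _ => Nat.coprime_one_right c)
      (fun c hc p hp => by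
        have hcz : c ≤ ⌊z⌋₊ := (Finset.mem_Icc.1 hc).2
        have : p ≤ c := Nat.le_of_mem_primeFactors hp
        have : ((p : ℕ) : ℝ) ≤ (⌊z⌋₊ : ℝ) := by exact_mod_cast this.trans hcz
        linarith)
    rw [neg_zero, Real.rpow_zero, one_mul, mul_zero, zero_mul, zero_mul, add_zero] at hr
    exact hr
  have hU1 := hUsum hfh0 hfh1 hfhmul hfhB hfhA
  have hU2 := hUsum hgh0 hgh1 hghmul hghB hghA
  have hE0 : 0 ≤ ∑ e ∈ E, Aw e := Finset.sum_nonneg fun e _ => by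
    simp only [hAw]; have := hfh0 e.1; have := hgh0 e.2; positivity
  have hU10 : 0 ≤ ∑ u ∈ U, fh u / u := Finset.sum_nonneg fun u _ => div_nonneg (hfh0 u) (Nat.cast_nonneg u)
  have hU20 : 0 ≤ ∑ u ∈ U, gh u / u := Finset.sum_nonneg fun u _ => div_nonneg (hgh0 u) (Nat.cast_nonneg u)
  calc (∑ e ∈ E, Aw e) * (∑ u ∈ U, fh u / u) * (∑ u ∈ U, gh u / u)
      ≤ (Real.exp (160 * Â' ^ 2) * ∏ p ∈ h.primeFactors, (1 + fh p * gh p / p)) *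
        Real.exp (∑ p ∈ Shiu.primesBelowNotDvd ((⌊z⌋₊ : ℝ) + 1) 1, fh p / p + Shiu.K₅ A B') *
        Real.exp (∑ p ∈ Shiu.primesBelowNotDvd ((⌊z⌋₊ : ℝ) + 1) 1, gh p / p + Shiu.K₅ A B') := by
        refine mul_le_mul (mul_le_mul hE hU1 hU10 (hE0.trans hE)) hU2 hU20 ?_
        exact mul_nonneg (hE0.trans hE) (hU10.trans hU1)
    _ = _ := by ring

/-! ### Class I -/

set_option maxHeartbeats 1600000 in
/-- **Class I** (Shiu's `∑_I` for `Q(n) = n(mn+h)`, sifting level `z = w²`): the `n ≤ N` with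
`Q(n) > z` and cut prime `P_n > w`. With `ψ(k) = ∏_{p ∣ k, p ≠ 2} (p−1)/(p−2)`,
`V = ∏_{2<p<w} (1 − 2/p)`, `f̂ = fψ`, `ĝ = gψ`:
`∑_I f(n) g(mn+h) ≤ C₀ B^{2M} (V ψ(h)ψ(m) N · e^{640Â²} ∏_{p ∣ h}(1 + 4f(p)g(p)/p) ·
e^{∑_{p ≤ z} f̂(p)/p + K₅} e^{∑_{p ≤ z} ĝ(p)/p + K₅} + A² z^{1/3} z² (ψ(h)ψ(m) + w^{19} log² w))`.
[cite: Shiu1980, §5 (∑_I)] [cite: MatomakiMerikoski2023, Lemma 3.1] -/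
theorem class_I_le : ∃ C : ℝ, 0 < C ∧
    ∀ {f g : ℕ → ℝ}, (∀ n, 0 ≤ f n) → (∀ n, 0 ≤ g n) → f 1 = 1 → g 1 = 1 →
    (∀ a b : ℕ, a.Coprime b → f (a * b) = f a * f b) →
    (∀ a b : ℕ, a.Coprime b → g (a * b) = g a * g b) →
    ∀ {B : ℝ}, 1 ≤ B → (∀ p l : ℕ, p.Prime → 1 ≤ l → f (p ^ l) ≤ B ^ l) →
    (∀ p l : ℕ, p.Prime → 1 ≤ l → g (p ^ l) ≤ B ^ l) →
    ∀ {A : ℝ}, (∀ n : ℕ, 1 ≤ n →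
      f n * (∏ p ∈ n.primeFactors.erase 2, (((p : ℝ) - 1) / ((p : ℝ) - 2))) ≤ A * (n : ℝ) ^ (1 / 6 : ℝ)) →
    (∀ n : ℕ, 1 ≤ n →
      g n * (∏ p ∈ n.primeFactors.erase 2, (((p : ℝ) - 1) / ((p : ℝ) - 2))) ≤ A * (n : ℝ) ^ (1 / 6 : ℝ)) →
    ∀ {Â : ℝ}, 0 ≤ Â → (∀ p a : ℕ, p.Prime → 1 ≤ a → f (p ^ a) ≤ Â * ((p : ℝ) ^ a) ^ (1 / 8 : ℝ)) →
    (∀ p a : ℕ, p.Prime → 1 ≤ a → g (p ^ a) ≤ Â * ((p : ℝ) ^ a) ^ (1 / 8 : ℝ)) →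
    ∀ {m h N : ℕ}, 1 ≤ m → 1 ≤ h → m.Coprime h →
    ∀ {w : ℝ}, 2 ≤ w → ∀ {M : ℕ}, Real.log N / Real.log w ≤ M →
    Real.log ((m * N + h : ℕ) : ℝ) / Real.log w ≤ M →
    ∑ n ∈ (Icc 1 N).filter (fun n : ℕ => w * w < ((n * (m * n + h) : ℕ) : ℝ) ∧
        w < (Shiu.cutPrime (w * w) (n * (m * n + h)) : ℝ)), f n * g (m * n + h) ≤
      C * B ^ (2 * M) *
        ((∏ p ∈ (Nat.primesBelow ⌈w⌉₊).erase 2, (1 - 2 / (p : ℝ))) *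
          (∏ p ∈ h.primeFactors.erase 2, (((p : ℝ) - 1) / ((p : ℝ) - 2))) *
          (∏ p ∈ m.primeFactors.erase 2, (((p : ℝ) - 1) / ((p : ℝ) - 2))) * N *
          (Real.exp (640 * Â ^ 2) * ∏ p ∈ h.primeFactors, (1 + 4 * f p * g p / p)) *
          (Real.exp (∑ p ∈ Shiu.primesBelowNotDvd ((⌊w * w⌋₊ : ℝ) + 1) 1,
              f p * (∏ q ∈ p.primeFactors.erase 2, (((q : ℝ) - 1) / ((q : ℝ) - 2))) / p +
              Shiu.K₅ A (2 * B)) *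
           Real.exp (∑ p ∈ Shiu.primesBelowNotDvd ((⌊w * w⌋₊ : ℝ) + 1) 1,
              g p * (∏ q ∈ p.primeFactors.erase 2, (((q : ℝ) - 1) / ((q : ℝ) - 2))) / p +
              Shiu.K₅ A (2 * B))) +
        A ^ 2 * (w * w) ^ (1 / 3 : ℝ) * (w * w) ^ 2 *
          ((∏ p ∈ h.primeFactors.erase 2, (((p : ℝ) - 1) / ((p : ℝ) - 2))) *
            (∏ p ∈ m.primeFactors.erase 2, (((p : ℝ) - 1) / ((p : ℝ) - 2))) +
            w ^ (19 : ℕ) * Real.log w ^ 2)) := by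
  obtain ⟨C₀, hC₀, hcard⟩ := PairShiuCount.card_le
  refine ⟨C₀, hC₀, ?_⟩
  intro f g hf0 hg0 hf1 hg1 hfmul hgmul B hB1 hfB hgB A hfA hgA Â hÂ hfÂ hgÂ m h N hm hh hmh w hw M hM₁ hM₂
  -- notation
  set ψ : ℕ → ℝ := fun k => ∏ p ∈ k.primeFactors.erase 2, (((p : ℝ) - 1) / ((p : ℝ) - 2)) with hψ
  set fh : ℕ → ℝ := fun n => f n * ψ n with hfh
  set gh : ℕ → ℝ := fun n => g n * ψ n with hgh
  set PP : ℕ := ∏ p ∈ (Nat.primesBelow ⌈w⌉₊).erase 2, p with hPP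
  set V : ℝ := ∏ p ∈ (Nat.primesBelow ⌈w⌉₊).erase 2, (1 - 2 / (p : ℝ)) with hV
  set hP : ℕ → ℕ := fun k => ∏ q ∈ h.primeFactors, q ^ k.factorization q with hhP
  set S := (Icc 1 N).filter (fun n : ℕ => w * w < ((n * (m * n + h) : ℕ) : ℝ) ∧
        w < (Shiu.cutPrime (w * w) (n * (m * n + h)) : ℝ)) with hS
  set pr : ℕ → ℕ × ℕ := fun n =>
    (smoothPart (Shiu.cutPrime (w * w) (n * (m * n + h))) n,
     smoothPart (Shiu.cutPrime (w * w) (n * (m * n + h))) (m * n + h)) with hpr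
  set T := S.image pr with hT
  set Ef : ℝ := Real.exp (∑ p ∈ Shiu.primesBelowNotDvd ((⌊w * w⌋₊ : ℝ) + 1) 1,
      f p * ψ p / p + Shiu.K₅ A (2 * B)) with hEf
  set Eg : ℝ := Real.exp (∑ p ∈ Shiu.primesBelowNotDvd ((⌊w * w⌋₊ : ℝ) + 1) 1,
      g p * ψ p / p + Shiu.K₅ A (2 * B)) with hEg
  set Δ : ℝ := Real.exp (640 * Â ^ 2) * ∏ p ∈ h.primeFactors, (1 + 4 * f p * g p / p) with hΔ
  -- basic positivity
  have hw0 : 0 < w := by linarith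
  have hw1 : 1 < w := by linarith
  have hz1 : 1 ≤ w * w := by nlinarith
  have hlogw : 0 < Real.log w := Real.log_pos hw1
  have hψ1 : ∀ k, 1 ≤ ψ k := fun k => PairShiuLocal.one_le_psi k
  have hψ0 : ∀ k, 0 ≤ ψ k := fun k => PairShiuLocal.psi_nonneg k
  obtain ⟨hPPdvd, hPPodd, hPPpf, hPPfacts⟩ := oddProd_facts w
  have hfac : ∀ p ∈ (Nat.primesBelow ⌈w⌉₊).erase 2, 0 ≤ 1 - 2 / (p : ℝ) ∧ 1 - 2 / (p : ℝ) ≤ 1 := by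
    intro p hp
    rw [← hPPpf] at hp
    obtain ⟨hpp, hp2, -⟩ := hPPfacts p hp
    have hp3 : (3 : ℝ) ≤ p := by
      exact_mod_cast (Nat.succ_le_of_lt (lt_of_le_of_ne hpp.two_le (Ne.symm hp2)))
    constructor
    · rw [sub_nonneg, div_le_one (by linarith)]; linarith
    · have : 0 ≤ 2 / (p : ℝ) := by positivity
      linarith
  have hV01 : 0 ≤ V ∧ V ≤ 1 :=
    ⟨Finset.prod_nonneg fun p hp => (hfac p hp).1,
     Finset.prod_le_one (fun p hp => (hfac p hp).1) fun p hp => (hfac p hp).2⟩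
  -- the modified weights
  have hfh0 : ∀ n, 0 ≤ fh n := fun n => mul_nonneg (hf0 n) (hψ0 n)
  have hgh0 : ∀ n, 0 ≤ gh n := fun n => mul_nonneg (hg0 n) (hψ0 n)
  have hfh1 : fh 1 = 1 := by simp [hfh, hf1, hψ]
  have hgh1 : gh 1 = 1 := by simp [hgh, hg1, hψ]
  have hfhmul : ∀ a b : ℕ, a.Coprime b → fh (a * b) = fh a * fh b := by
    intro a b hab
    simp only [hfh, hψ]
    rw [hfmul a b hab, PairShiuLocal.psi_mul_of_coprime hab]; ring
  have hghmul : ∀ a b : ℕ, a.Coprime b → gh (a * b) = gh a * gh b := by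
    intro a b hab
    simp only [hgh, hψ]
    rw [hgmul a b hab, PairShiuLocal.psi_mul_of_coprime hab]; ring
  have h2B1 : 1 ≤ 2 * B := by linarith
  have hψpow : ∀ p l : ℕ, p.Prime → ψ (p ^ l) ≤ 2 := fun p l hp => PairShiuLocal.psi_prime_pow_le_two hp l
  have h2pow : ∀ l : ℕ, 1 ≤ l → (2 : ℝ) ≤ 2 ^ l := fun l hl => by
    calc (2 : ℝ) = 2 ^ 1 := by norm_num
      _ ≤ 2 ^ l := pow_le_pow_right₀ (by norm_num) hl
  have hfhB : ∀ p l : ℕ, p.Prime → 1 ≤ l → fh (p ^ l) ≤ (2 * B) ^ l := by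
    intro p l hp hl
    simp only [hfh]
    calc f (p ^ l) * ψ (p ^ l) ≤ B ^ l * 2 :=
          mul_le_mul (hfB p l hp hl) (hψpow p l hp) (hψ0 _) (by positivity)
      _ ≤ B ^ l * 2 ^ l := mul_le_mul_of_nonneg_left (h2pow l hl) (by positivity)
      _ = (2 * B) ^ l := by rw [mul_pow]; ring
  have hghB : ∀ p l : ℕ, p.Prime → 1 ≤ l → gh (p ^ l) ≤ (2 * B) ^ l := by
    intro p l hp hl
    simp only [hgh]
    calc g (p ^ l) * ψ (p ^ l) ≤ B ^ l * 2 :=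
          mul_le_mul (hgB p l hp hl) (hψpow p l hp) (hψ0 _) (by positivity)
      _ ≤ B ^ l * 2 ^ l := mul_le_mul_of_nonneg_left (h2pow l hl) (by positivity)
      _ = (2 * B) ^ l := by rw [mul_pow]; ring
  have hfhÂ : ∀ p a : ℕ, p.Prime → 1 ≤ a → fh (p ^ a) ≤ (2 * Â) * ((p : ℝ) ^ a) ^ (1 / 8 : ℝ) := by
    intro p a hp ha
    simp only [hfh]
    calc f (p ^ a) * ψ (p ^ a) ≤ (Â * ((p : ℝ) ^ a) ^ (1 / 8 : ℝ)) * 2 :=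
          mul_le_mul (hfÂ p a hp ha) (hψpow p a hp) (hψ0 _) (by positivity)
      _ = (2 * Â) * ((p : ℝ) ^ a) ^ (1 / 8 : ℝ) := by ring
  have hghÂ : ∀ p a : ℕ, p.Prime → 1 ≤ a → gh (p ^ a) ≤ (2 * Â) * ((p : ℝ) ^ a) ^ (1 / 8 : ℝ) := by
    intro p a hp ha
    simp only [hgh]
    calc g (p ^ a) * ψ (p ^ a) ≤ (Â * ((p : ℝ) ^ a) ^ (1 / 8 : ℝ)) * 2 :=
          mul_le_mul (hgÂ p a hp ha) (hψpow p a hp) (hψ0 _) (by positivity)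
      _ = (2 * Â) * ((p : ℝ) ^ a) ^ (1 / 8 : ℝ) := by ring
  -- facts about the elements of `S`
  have hSfacts : ∀ n ∈ S, n ≠ 0 ∧ m * n + h ≠ 0 ∧ (1 ≤ n ∧ n ≤ N) ∧
      (Shiu.cutPrime (w * w) (n * (m * n + h))).Prime ∧
      w < (Shiu.cutPrime (w * w) (n * (m * n + h)) : ℝ) ∧
      (pr n).1 * (n / (pr n).1) = n ∧ (pr n).2 * ((m * n + h) / (pr n).2) = m * n + h ∧
      (pr n).1.Coprime (n / (pr n).1) ∧ (pr n).2.Coprime ((m * n + h) / (pr n).2) ∧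
      (∀ p ∈ (n / (pr n).1).primeFactors, w ≤ (p : ℝ)) ∧
      (∀ p ∈ ((m * n + h) / (pr n).2).primeFactors, w ≤ (p : ℝ)) ∧
      ((pr n).1 : ℝ) * (pr n).2 ≤ w * w ∧ 1 ≤ (pr n).1 ∧ 1 ≤ (pr n).2 := by
    intro n hn
    rw [hS, Finset.mem_filter, Finset.mem_Icc] at hn
    obtain ⟨⟨hn1, hnN⟩, hzQ, hwP⟩ := hn
    have hn0 : n ≠ 0 := by omega
    have hL0 : m * n + h ≠ 0 := by omega
    set Qn := n * (m * n + h) with hQn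
    have hQ2 : 2 ≤ Qn := by
      have h4 : (4 : ℝ) ≤ w * w := by nlinarith
      have : (4 : ℝ) < (Qn : ℝ) := lt_of_le_of_lt h4 hzQ
      exact_mod_cast (show (2 : ℝ) ≤ Qn by linarith)
    obtain ⟨hPmem, hcz⟩ := Shiu.cutPrime_mem (n := Qn) (z := w * w) hQ2 hz1
    set P := Shiu.cutPrime (w * w) Qn with hPdef
    have hPp : P.Prime := Nat.prime_of_mem_primeFactors hPmem
    have hc1 : (pr n).1 = smoothPart P n := rfl
    have hc2 : (pr n).2 = smoothPart P (m * n + h) := rfl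
    have hsplit : Shiu.cPart (w * w) Qn = (pr n).1 * (pr n).2 := by
      rw [hc1, hc2, Shiu.cPart, hQn]
      exact smoothPart_mul hn0 hL0 _
    refine ⟨hn0, hL0, ⟨hn1, hnN⟩, hPp, hwP, ?_, ?_, ?_, ?_, ?_, ?_, ?_, ?_, ?_⟩
    · rw [hc1]; exact smoothPart_mul_div hn0 P
    · rw [hc2]; exact smoothPart_mul_div hL0 P
    · rw [hc1]; exact coprime_smoothPart_div hn0
    · rw [hc2]; exact coprime_smoothPart_div hL0
    · intro p hp
      rw [hc1] at hp
      have h1 := le_of_prime_dvd_div_smoothPart hn0 (Nat.prime_of_mem_primeFactors hp)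
        (Nat.dvd_of_mem_primeFactors hp)
      have h2 : (P : ℝ) ≤ p := by exact_mod_cast h1
      linarith
    · intro p hp
      rw [hc2] at hp
      have h1 := le_of_prime_dvd_div_smoothPart hL0 (Nat.prime_of_mem_primeFactors hp)
        (Nat.dvd_of_mem_primeFactors hp)
      have h2 : (P : ℝ) ≤ p := by exact_mod_cast h1
      linarith
    · have := hcz; rw [hsplit] at this; exact_mod_cast this
    · exact Nat.one_le_iff_ne_zero.mpr (smoothPart_ne_zero _ _)
    · exact Nat.one_le_iff_ne_zero.mpr (smoothPart_ne_zero _ _)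
  -- the pointwise bound on a fibre
  have hpt : ∀ n ∈ S, f n * g (m * n + h) ≤ f (pr n).1 * g (pr n).2 * B ^ (2 * M) := by
    intro n hn
    obtain ⟨hn0, hL0, ⟨hn1, hnN⟩, -, -, hcd1, hcd2, hcop1, hcop2, hpr1, hpr2, -, -, -⟩ := hSfacts n hn
    set d₁ := n / (pr n).1 with hd₁
    set d₂ := (m * n + h) / (pr n).2 with hd₂
    have hd₁0 : d₁ ≠ 0 := fun h0 => hn0 (by rw [← hcd1, h0, mul_zero])
    have hd₂0 : d₂ ≠ 0 := fun h0 => hL0 (by rw [← hcd2, h0, mul_zero])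
    have hf : f n = f (pr n).1 * f d₁ := by
      conv_lhs => rw [← hcd1]
      exact hfmul _ _ hcop1
    have hg : g (m * n + h) = g (pr n).2 * g d₂ := by
      conv_lhs => rw [← hcd2]
      exact hgmul _ _ hcop2
    -- `Ω(d₁), Ω(d₂) ≤ M`
    have hd₁N : (d₁ : ℝ) ≤ N := by
      have : d₁ ≤ n := Nat.div_le_self n _
      exact_mod_cast this.trans hnN
    have hd₂N : (d₂ : ℝ) ≤ ((m * N + h : ℕ) : ℝ) := by
      have : d₂ ≤ m * n + h := Nat.div_le_self _ _
      have h2 : m * n + h ≤ m * N + h := by nlinarith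
      exact_mod_cast this.trans h2
    have hΩ₁ : Shiu.bigOmega d₁ ≤ M := by
      have := Shiu.bigOmega_le_div_log hd₁0 hw1 hpr1 hd₁N
      exact_mod_cast this.trans hM₁
    have hΩ₂ : Shiu.bigOmega d₂ ≤ M := by
      have := Shiu.bigOmega_le_div_log hd₂0 hw1 hpr2 hd₂N
      exact_mod_cast this.trans hM₂
    have hfd : f d₁ ≤ B ^ M :=
      (Shiu.le_pow_bigOmega hf0 hf1 hfmul hfB hd₁0).trans (pow_le_pow_right₀ hB1 hΩ₁)
    have hgd : g d₂ ≤ B ^ M :=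
      (Shiu.le_pow_bigOmega hg0 hg1 hgmul hgB hd₂0).trans (pow_le_pow_right₀ hB1 hΩ₂)
    rw [hf, hg]
    have h1 := hf0 (pr n).1
    have h2 := hg0 (pr n).2
    calc f (pr n).1 * f d₁ * (g (pr n).2 * g d₂) = (f (pr n).1 * g (pr n).2) * (f d₁ * g d₂) := by ring
      _ ≤ (f (pr n).1 * g (pr n).2) * (B ^ M * B ^ M) :=
          mul_le_mul_of_nonneg_left (mul_le_mul hfd hgd (hg0 _) (by positivity)) (mul_nonneg h1 h2)
      _ = f (pr n).1 * g (pr n).2 * B ^ (2 * M) := by rw [two_mul, pow_add]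
  -- the fibre over `c ∈ T` sits inside the sifted set `D(c)` and is non-empty
  have hfibre : ∀ c ∈ T,
      (S.filter (fun n => pr n = c)) ⊆ ((Icc 1 N).filter fun n : ℕ => c.1 ∣ n ∧ c.2 ∣ m * n + h ∧
        (n / c.1).Coprime PP ∧ ((m * n + h) / c.2).Coprime PP) ∧
      ((Icc 1 N).filter fun n : ℕ => c.1 ∣ n ∧ c.2 ∣ m * n + h ∧
        (n / c.1).Coprime PP ∧ ((m * n + h) / c.2).Coprime PP).Nonempty ∧
      1 ≤ c.1 ∧ 1 ≤ c.2 ∧ ((c.1 : ℝ) * c.2 ≤ w * w) ∧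
      (Nat.gcd (m * c.1) c.2 : ℝ) ≤ Nat.gcd (hP c.1) (hP c.2) ∧
      (∀ p ∈ h.primeFactors, c.1.factorization p = 0 ↔ c.2.factorization p = 0) := by
    intro c hc
    rw [hT, Finset.mem_image] at hc
    obtain ⟨n₀, hn₀S, hn₀c⟩ := hc
    obtain ⟨hn₀0, hL₀0, hn₀I, hP₀, -, hcd1, hcd2, -, -, hpr1, hpr2, hcz, hc1, hc2⟩ := hSfacts n₀ hn₀S
    -- the coupling at the primes of `h`, read off from `n₀`
    have hcouple : ∀ p ∈ h.primeFactors, c.1.factorization p = 0 ↔ c.2.factorization p = 0 := by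
      intro p hp
      have hpp := Nat.prime_of_mem_primeFactors hp
      have hph := Nat.dvd_of_mem_primeFactors hp
      have hpm : ¬ p ∣ m := fun hpm => by
        have := Nat.dvd_gcd hpm hph
        rw [hmh.gcd_eq_one] at this
        exact hpp.one_lt.ne' (Nat.dvd_one.mp this)
      rw [← hn₀c]
      change (smoothPart _ n₀).factorization p = 0 ↔ (smoothPart _ (m * n₀ + h)).factorization p = 0
      rw [factorization_smoothPart, factorization_smoothPart]
      split_ifs with hlt
      · exact factorization_eq_zero_iff_lin hpp hph hpm hn₀0
      · exact Iff.rfl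
    rw [hn₀c] at hcd1 hcd2 hpr1 hpr2 hcz hc1 hc2
    -- membership of the fibre in `D(c)`
    have hsub : (S.filter (fun n => pr n = c)) ⊆ ((Icc 1 N).filter fun n : ℕ => c.1 ∣ n ∧
        c.2 ∣ m * n + h ∧ (n / c.1).Coprime PP ∧ ((m * n + h) / c.2).Coprime PP) := by
      intro n hn
      rw [Finset.mem_filter] at hn
      obtain ⟨hnS, hnc⟩ := hn
      obtain ⟨hn0, hL0, hnI, -, -, hd1, hd2, -, -, hq1, hq2, -, -, -⟩ := hSfacts n hnS
      rw [hnc] at hd1 hd2 hq1 hq2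
      rw [Finset.mem_filter, Finset.mem_Icc]
      refine ⟨hnI, ⟨n / c.1, hd1.symm⟩, ⟨(m * n + h) / c.2, hd2.symm⟩, ?_, ?_⟩
      · exact coprime_oddProd_of_le (fun h0 => hn0 (by rw [← hd1, h0, mul_zero])) hq1
      · exact coprime_oddProd_of_le (fun h0 => hL0 (by rw [← hd2, h0, mul_zero])) hq2
    have hn₀mem : n₀ ∈ S.filter (fun n => pr n = c) := Finset.mem_filter.mpr ⟨hn₀S, hn₀c⟩
    refine ⟨hsub, ⟨n₀, hsub hn₀mem⟩, hc1, hc2, hcz, ?_, hcouple⟩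
    -- the gcd bound
    set G := Nat.gcd (m * c.1) c.2 with hG
    have hc1n : c.1 ∣ n₀ := ⟨n₀ / c.1, hcd1.symm⟩
    have hc2L : c.2 ∣ m * n₀ + h := ⟨(m * n₀ + h) / c.2, hcd2.symm⟩
    have hGh : G ∣ Nat.gcd n₀ h := by
      have a : G ∣ m * n₀ := (Nat.gcd_dvd_left _ _).trans (mul_dvd_mul_left m hc1n)
      have b : G ∣ m * n₀ + h := (Nat.gcd_dvd_right _ _).trans hc2L
      have hab := Nat.dvd_gcd a b
      rw [show m * n₀ + h = h + 1 * (m * n₀) by ring, Nat.gcd_add_mul_right_right,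
        hmh.gcd_mul_left_cancel n₀] at hab
      exact hab
    have hGdh : G ∣ h := hGh.trans (Nat.gcd_dvd_right _ _)
    have hGm : G.Coprime m := Nat.Coprime.coprime_dvd_left hGdh hmh.symm
    have hGc1 : G ∣ c.1 := hGm.dvd_of_dvd_mul_left (Nat.gcd_dvd_left _ _)
    have hGc2 : G ∣ c.2 := Nat.gcd_dvd_right _ _
    have hGsupp : G.primeFactors ⊆ h.primeFactors := Nat.primeFactors_mono hGdh (by omega)
    have h1 : G ∣ hP c.1 := dvd_hPart_of_dvd (by omega) hGc1 hGsupp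
    have h2 : G ∣ hP c.2 := dvd_hPart_of_dvd (by omega) hGc2 hGsupp
    have h3 : G ∣ Nat.gcd (hP c.1) (hP c.2) := Nat.dvd_gcd h1 h2
    have h4 : G ≤ Nat.gcd (hP c.1) (hP c.2) :=
      Nat.le_of_dvd (Nat.gcd_pos_of_pos_left _ (Nat.pos_of_ne_zero (hPart_ne_zero h _))) h3
    exact_mod_cast h4
  -- the bound for one fibre
  have hone : ∀ c ∈ T, ∑ n ∈ S.filter (fun n => pr n = c), f n * g (m * n + h) ≤
      C₀ * B ^ (2 * M) * (N * V * ψ h * ψ m *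
        (fh c.1 * gh c.2 * (Nat.gcd (hP c.1) (hP c.2) : ℝ) / ((c.1 : ℝ) * c.2)) +
        A ^ 2 * (w * w) ^ (1 / 3 : ℝ) * (ψ h * ψ m + w ^ (19 : ℕ) * Real.log w ^ 2)) := by
    intro c hc
    obtain ⟨hsub, hDne, hc1, hc2, hcz, hGle, -⟩ := hfibre c hc
    have hcount := hcard N m h c.1 c.2 w PP hw hPPdvd hPPodd hm hh hc1 hc2 hDne
    rw [hPPpf] at hcount
    have hE0 : h * m * c.1 * c.2 ≠ 0 := by
      refine Nat.mul_ne_zero (Nat.mul_ne_zero (Nat.mul_ne_zero ?_ ?_) ?_) ?_ <;> omega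
    have hcorr : ∏ p ∈ ((Nat.primesBelow ⌈w⌉₊).erase 2).filter (· ∣ h * m * c.1 * c.2),
        (((p : ℝ) - 1) / ((p : ℝ) - 2)) ≤ ψ h * ψ m * ψ c.1 * ψ c.2 :=
      (PairShiuLocal.prod_filter_dvd_le_psi (S := (Nat.primesBelow ⌈w⌉₊).erase 2)
        (fun p hp => by rw [← hPPpf] at hp; exact ⟨(hPPfacts p hp).1, (hPPfacts p hp).2.1⟩) hE0).trans
        (PairShiuLocal.psi_mul_four_le h m c.1 c.2)
    have hcorr0 : 0 ≤ ∏ p ∈ ((Nat.primesBelow ⌈w⌉₊).erase 2).filter (· ∣ h * m * c.1 * c.2),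
        (((p : ℝ) - 1) / ((p : ℝ) - 2)) := by
      refine Finset.prod_nonneg fun p hp => ?_
      have hp' := (Finset.mem_filter.mp hp).1
      rw [← hPPpf] at hp'
      exact zero_le_one.trans (PairShiuLocal.psi_factor_bounds (hPPfacts p hp').1 (hPPfacts p hp').2.1).1
    -- the constant `A ≥ 1`
    have hA1 : 1 ≤ A := by
      have := hfA 1 le_rfl
      simp only [hf1, Nat.cast_one, Real.one_rpow, mul_one, one_mul] at this
      simpa [hψ] using this
    set z6 : ℝ := (w * w) ^ (1 / 6 : ℝ) with hz6
    have hz6sq : z6 ^ 2 = (w * w) ^ (1 / 3 : ℝ) := by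
      rw [hz6, ← Real.rpow_natCast, ← Real.rpow_mul (by positivity)]; norm_num
    have hcz1 : (c.1 : ℝ) ≤ w * w := by
      have : (1 : ℝ) ≤ c.2 := by exact_mod_cast hc2
      nlinarith [show (0 : ℝ) ≤ c.1 by positivity]
    have hcz2 : (c.2 : ℝ) ≤ w * w := by
      have : (1 : ℝ) ≤ c.1 := by exact_mod_cast hc1
      nlinarith [show (0 : ℝ) ≤ c.2 by positivity]
    have hfz : f c.1 * ψ c.1 ≤ A * z6 := by
      refine (hfA c.1 hc1).trans (mul_le_mul_of_nonneg_left ?_ (by linarith))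
      exact Real.rpow_le_rpow (Nat.cast_nonneg _) hcz1 (by norm_num)
    have hgz : g c.2 * ψ c.2 ≤ A * z6 := by
      refine (hgA c.2 hc2).trans (mul_le_mul_of_nonneg_left ?_ (by linarith))
      exact Real.rpow_le_rpow (Nat.cast_nonneg _) hcz2 (by norm_num)
    have hcnt : (#((Icc 1 N).filter fun n : ℕ => c.1 ∣ n ∧ c.2 ∣ m * n + h ∧
        (n / c.1).Coprime PP ∧ ((m * n + h) / c.2).Coprime PP) : ℝ) ≤
        C₀ * ((N : ℝ) * Nat.gcd (m * c.1) c.2 / ((c.1 : ℝ) * c.2) + 1) *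
          (V * ∏ p ∈ ((Nat.primesBelow ⌈w⌉₊).erase 2).filter (· ∣ h * m * c.1 * c.2),
            (((p : ℝ) - 1) / ((p : ℝ) - 2))) + C₀ * (w ^ (19 : ℕ) * Real.log w ^ 2) := by
      have := hcount; linarith
    have halg := fibre_algebra (hf0 c.1) (hg0 c.2) (hψ1 c.1) (hψ1 c.2) (hψ0 h) (hψ0 m) hV01.1 hV01.2
      (Nat.cast_nonneg N) (Nat.cast_nonneg _) hGle (by exact_mod_cast hc1) (by exact_mod_cast hc2)
      hcorr0 hcorr hC₀.le (by positivity) hcnt (by linarith) hfz hgz (by positivity)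
      (show 0 ≤ B ^ (2 * M) by positivity)
    rw [hz6sq] at halg
    calc ∑ n ∈ S.filter (fun n => pr n = c), f n * g (m * n + h)
        ≤ ∑ n ∈ S.filter (fun n => pr n = c), f c.1 * g c.2 * B ^ (2 * M) := by
          refine Finset.sum_le_sum fun n hn => ?_
          obtain ⟨hnS, hnc⟩ := Finset.mem_filter.mp hn
          have := hpt n hnS
          rwa [hnc] at this
      _ = #(S.filter (fun n => pr n = c)) * (f c.1 * g c.2 * B ^ (2 * M)) := by
          rw [Finset.sum_const, nsmul_eq_mul]
      _ ≤ #((Icc 1 N).filter fun n : ℕ => c.1 ∣ n ∧ c.2 ∣ m * n + h ∧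
            (n / c.1).Coprime PP ∧ ((m * n + h) / c.2).Coprime PP) * (f c.1 * g c.2 * B ^ (2 * M)) := by
          have h1 := hf0 c.1; have h2 := hg0 c.2
          gcongr
      _ = f c.1 * g c.2 * B ^ (2 * M) * #((Icc 1 N).filter fun n : ℕ => c.1 ∣ n ∧ c.2 ∣ m * n + h ∧
            (n / c.1).Coprime PP ∧ ((m * n + h) / c.2).Coprime PP) := by ring
      _ ≤ _ := halg
  -- the main sum over `T`
  have hmainT : ∑ c ∈ T, fh c.1 * gh c.2 * (Nat.gcd (hP c.1) (hP c.2) : ℝ) / ((c.1 : ℝ) * c.2) ≤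
      Δ * (Ef * Eg) := by
    have h2Â : 0 ≤ 2 * Â := by linarith
    have hTT : ∀ c ∈ T, 1 ≤ c.1 ∧ 1 ≤ c.2 ∧ (c.1 : ℝ) ≤ w * w ∧ (c.2 : ℝ) ≤ w * w ∧
        ∀ p ∈ h.primeFactors, c.1.factorization p = 0 ↔ c.2.factorization p = 0 := by
      intro c hc
      obtain ⟨-, -, hc1, hc2, hcz, -, hcouple⟩ := hfibre c hc
      refine ⟨hc1, hc2, ?_, ?_, hcouple⟩
      · have : (1 : ℝ) ≤ c.2 := by exact_mod_cast hc2
        nlinarith [show (0 : ℝ) ≤ c.1 by positivity]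
      · have : (1 : ℝ) ≤ c.1 := by exact_mod_cast hc1
        nlinarith [show (0 : ℝ) ≤ c.2 by positivity]
    have hmain := mainSum_le hfh0 hgh0 hfh1 hgh1 hfhmul hghmul h2B1 hfhB hghB
      (fun n hn => hfA n hn) (fun n hn => hgA n hn) h2Â hfhÂ hghÂ (show h ≠ 0 by omega) hz1 T hTT
    refine hmain.trans ?_
    have hEfg : 0 ≤ Ef * Eg := by positivity
    refine mul_le_mul_of_nonneg_right ?_ hEfg
    -- compare the local factors
    rw [hΔ, show (160 : ℝ) * (2 * Â) ^ 2 = 640 * Â ^ 2 by ring]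
    refine mul_le_mul_of_nonneg_left ?_ (by positivity)
    refine Finset.prod_le_prod (fun p _ => by have := hfh0 p; have := hgh0 p; positivity) fun p hp => ?_
    have hpp := Nat.prime_of_mem_primeFactors hp
    have hp0 : (0 : ℝ) < p := by exact_mod_cast hpp.pos
    have hψp : ψ p ≤ 2 := by have := hψpow p 1 hpp; rwa [pow_one] at this
    have : fh p * gh p ≤ 4 * f p * g p := by
      simp only [hfh, hgh]
      have hf := hf0 p; have hg := hg0 p; have hψ0p := hψ0 p
      calc f p * ψ p * (g p * ψ p) = (f p * g p) * (ψ p * ψ p) := by ring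
        _ ≤ (f p * g p) * (2 * 2) :=
            mul_le_mul_of_nonneg_left (mul_le_mul hψp hψp hψ0p (by norm_num)) (mul_nonneg hf hg)
        _ = 4 * f p * g p := by ring
    have := div_le_div_of_nonneg_right this hp0.le
    rw [show 4 * f p * g p / (p : ℝ) = 4 * f p * g p / p from rfl] at this
    linarith
  -- the number of pairs
  have hTcard : (#T : ℝ) ≤ (w * w) ^ 2 := by
    have hsub : T ⊆ (Icc 1 ⌊w * w⌋₊) ×ˢ (Icc 1 ⌊w * w⌋₊) := by
      intro c hc
      obtain ⟨-, -, hc1, hc2, hcz, -, -⟩ := hfibre c hc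
      have hc1' : (1 : ℝ) ≤ c.1 := by exact_mod_cast hc1
      have hc2' : (1 : ℝ) ≤ c.2 := by exact_mod_cast hc2
      rw [Finset.mem_product, Finset.mem_Icc, Finset.mem_Icc]
      exact ⟨⟨hc1, Nat.le_floor (by nlinarith)⟩, ⟨hc2, Nat.le_floor (by nlinarith)⟩⟩
    calc (#T : ℝ) ≤ #((Icc 1 ⌊w * w⌋₊) ×ˢ (Icc 1 ⌊w * w⌋₊)) := by exact_mod_cast Finset.card_le_card hsub
      _ = (⌊w * w⌋₊ : ℝ) * ⌊w * w⌋₊ := by rw [Finset.card_product]; simp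
      _ ≤ (w * w) * (w * w) := by
          have := Nat.floor_le (by positivity : (0 : ℝ) ≤ w * w)
          exact mul_le_mul this this (Nat.cast_nonneg _) (by positivity)
      _ = (w * w) ^ 2 := by ring
  -- assemble
  have hmaps : ∀ n ∈ S, pr n ∈ T := fun n hn => Finset.mem_image_of_mem pr hn
  rw [← Finset.sum_fiberwise_of_maps_to hmaps]
  refine (Finset.sum_le_sum hone).trans ?_
  rw [← Finset.mul_sum, Finset.sum_add_distrib, Finset.sum_const, nsmul_eq_mul, ← Finset.mul_sum]
  have hK : 0 ≤ C₀ * B ^ (2 * M) := by positivity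
  have hpos1 : 0 ≤ (N : ℝ) * V * ψ h * ψ m := by
    have := hV01.1; have := hψ0 h; have := hψ0 m; positivity
  have hpos2 : 0 ≤ A ^ 2 * (w * w) ^ (1 / 3 : ℝ) * (ψ h * ψ m + w ^ (19 : ℕ) * Real.log w ^ 2) := by
    have := hψ0 h; have := hψ0 m; positivity
  calc C₀ * B ^ (2 * M) * ((N : ℝ) * V * ψ h * ψ m *
        ∑ c ∈ T, fh c.1 * gh c.2 * (Nat.gcd (hP c.1) (hP c.2) : ℝ) / ((c.1 : ℝ) * c.2) +
        #T * (A ^ 2 * (w * w) ^ (1 / 3 : ℝ) * (ψ h * ψ m + w ^ (19 : ℕ) * Real.log w ^ 2)))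
      ≤ C₀ * B ^ (2 * M) * ((N : ℝ) * V * ψ h * ψ m * (Δ * (Ef * Eg)) +
        (w * w) ^ 2 * (A ^ 2 * (w * w) ^ (1 / 3 : ℝ) * (ψ h * ψ m + w ^ (19 : ℕ) * Real.log w ^ 2))) := by
        refine mul_le_mul_of_nonneg_left (add_le_add ?_ ?_) hK
        · exact mul_le_mul_of_nonneg_left hmainT hpos1
        · exact mul_le_mul_of_nonneg_right hTcard hpos2
    _ = _ := by simp only [hΔ, hEf, hEg, hV, hψ]; ring

end PairShiu

end Literature.NumberTheory.Sieve
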